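import Literature.Computability.MetaComplexity.FpLinearSystems
import Mathlib.Data.Finset.Sort
import Mathlib.Order.SymmDiff
import Mathlib.Data.ZMod.Basic
import HarnessLib

/-!
# `MOD₂` summation, concrete level, II: row sets over `𝔽₂` and the canonical clauses of a row

Support file for item `stmt-PneNP-11444` (`LinearGeneratorModPFregeHard`), calibration line "for
`p = 2` the rung fails".  Elementary facts about systems `E : Fin m → LinEqMod 2 n` and their
`sumEncoding 1 E` (Beck's canonical CNF, block size `1`) used to instantiate the abstract
summation (`…Mod2Chain.lean`):

* `mem_foldl_symmDiff_iff` — membership in an iterated symmetric difference of sets is the parity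
  of the number of sets containing the element (as an identity in `ZMod 2`);
  `foldl_symmDiff_subset` — iterated symmetric differences stay inside a common bound;
* `eqVars_one`, `eqPred_one_iff` — for block size `1` the variable list of a row is its sorted
  support and its constraint is the parity of the true support variables;
* `map_mem_equationCNF_one` — every assignment of the support of the WRONG parity is excluded by a
  clause of `equationCNF 1 e` listing the support with the opposite signs (the clause the row fact
  of `…Mod2Row.lean` consumes).

No definitions are introduced.

Sources: C. Beck, *Time and Space in Proof Complexity* (2017), Def. 5.6 (`sumEncoding`, as in
`FpLinearSystems.lean`); P. Clote, E. Kranakis (2002), §5.5.3 (row sums over `𝔽₂` as symmetric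
differences); folklore.
-/

set_option linter.dupNamespace false -- `Summit.PneNP.PneNP.…`: summit = sub-problem (D-0017)

namespace Summit.PneNP.PneNP.Theorems.ModTwo

open Literature.Computability.Complexity Literature.Computability.MetaComplexity
open scoped symmDiff

/-! ### Iterated symmetric differences -/

/-- In `𝔽₂` the indicator of a symmetric difference is the sum of the indicators. [folklore] -/
theorem ite_mem_symmDiff_eq_add (X Y : Finset ℕ) (v : ℕ) :
    (if v ∈ X ∆ Y then (1 : ZMod 2) else 0) = (if v ∈ X then (1 : ZMod 2) else 0) +
      (if v ∈ Y then 1 else 0) := by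
  have h2 : (1 : ZMod 2) + 1 = 0 := by decide
  by_cases hX : v ∈ X <;> by_cases hY : v ∈ Y <;> simp [Finset.mem_symmDiff, hX, hY, h2]

/-- **Parity of iterated symmetric differences.** `v ∈ X ∆ f i₁ ∆ ⋯ ∆ f i_k` iff
`[v ∈ X] + Σ_j [v ∈ f i_j] = 1` in `ZMod 2`. [Clote–Kranakis 2002, §5.5.3] [folklore] -/
theorem mem_foldl_symmDiff_iff {ι : Type*} (f : ι → Finset ℕ) (v : ℕ) :
    ∀ (L : List ι) (X : Finset ℕ), v ∈ L.foldl (fun acc i => acc ∆ f i) X ↔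
      (if v ∈ X then (1 : ZMod 2) else 0) +
        (L.map fun i => if v ∈ f i then (1 : ZMod 2) else 0).sum = 1
  | [], X => by by_cases h : v ∈ X <;> simp [h]
  | i :: L, X => by
    rw [List.foldl_cons, mem_foldl_symmDiff_iff f v L (X ∆ f i), ite_mem_symmDiff_eq_add,
      List.map_cons, List.sum_cons, add_assoc]

/-- Iterated symmetric differences of subsets of `B` starting inside `B` stay inside `B`.
[folklore] -/
theorem foldl_symmDiff_subset {ι : Type*} (f : ι → Finset ℕ) (B : Finset ℕ) :
    ∀ (L : List ι) (X : Finset ℕ), X ⊆ B → (∀ i ∈ L, f i ⊆ B) →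
      L.foldl (fun acc i => acc ∆ f i) X ⊆ B
  | [], X, hX, _ => by simpa using hX
  | i :: L, X, hX, hL => by
    rw [List.foldl_cons]
    refine foldl_symmDiff_subset f B L _ ?_ (fun j hj => hL j (List.mem_cons_of_mem _ hj))
    intro v hv
    rcases Finset.mem_symmDiff.1 hv with ⟨h, -⟩ | ⟨h, -⟩
    · exact hX h
    · exact hL i List.mem_cons_self h

/-! ### Rows over `𝔽₂` with block size `1` -/

section Rows

variable {n : ℕ}

/-- A block of size `1` is the single variable `[i]`. [Beck 2017, Def. 5.6] [folklore] -/
theorem encBlock_one (i : ℕ) : encBlock 1 i = [i] := by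
  simp [encBlock, xorBlock]

/-- For block size `1` the variable list of a row is its support, sorted, as naturals.
[Beck 2017, Def. 5.6] [folklore] -/
theorem eqVars_one (e : LinEqMod 2 n) :
    eqVars 1 e = (e.supp.map Fin.valEmbedding).sort (· ≤ ·) := by
  have hflat : ∀ L : List ℕ, L.flatMap (encBlock 1) = L := by
    intro L
    induction L with
    | nil => rfl
    | cons a L ih => rw [List.flatMap_cons, ih, encBlock_one]; rfl
  rw [eqVars, hflat]
  exact Finset.map_sort Fin.valEmbedding _ (· ≤ ·) (· ≤ ·) (fun a _ b _ => Iff.rfl)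

/-- Membership in the sorted support. [folklore] -/
theorem mem_sort_supp_iff (e : LinEqMod 2 n) {v : ℕ} :
    v ∈ (e.supp.map Fin.valEmbedding).sort (· ≤ ·) ↔ ∃ j ∈ e.supp, (j : ℕ) = v := by
  simp [Finset.mem_sort, Finset.mem_map]

/-- **The row constraint for block size `1` is a parity.** `eqPred 1 e Sl` holds iff the number of
support variables lying in `Sl` has parity `e.2`. [Beck 2017, Def. 5.6] [folklore] -/
theorem eqPred_one_iff (e : LinEqMod 2 n) (Sl : List ℕ) :
    eqPred 1 e Sl = true ↔ (∑ j ∈ e.supp, if (j : ℕ) ∈ Sl then (1 : ZMod 2) else 0) = e.2 := by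
  rw [eqPred, decide_eq_true_iff]
  have hsum : (∑ i ∈ e.supp, e.1 i * (((encBlock 1 (i : ℕ)).filter fun v => decide (v ∈ Sl)).length
      : ZMod 2)) = ∑ j ∈ e.supp, if (j : ℕ) ∈ Sl then (1 : ZMod 2) else 0 := by
    refine Finset.sum_congr rfl fun i hi => ?_
    have h1 : e.1 i = 1 := by
      have hne : e.1 i ≠ 0 := by simpa [LinEqMod.supp] using hi
      revert hne; generalize e.1 i = a; revert a; decide
    rw [h1, one_mul, encBlock_one]
    by_cases h : (i : ℕ) ∈ Sl <;> simp [h]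
  rw [hsum]

/-- Sum over a sorted finset as a list sum. [folklore] -/
theorem sum_sort_map {α : Type*} [DecidableEq α] [LinearOrder α] (s : Finset α) (g : α → ZMod 2) :
    ((s.sort (· ≤ ·)).map g).sum = ∑ x ∈ s, g x := by
  rw [← List.sum_toFinset _ (Finset.sort_nodup _ _), Finset.sort_toFinset]

/-- The number of members of a list satisfying `ρ`, in `ZMod 2`, as a sum of indicators.
[folklore] -/
theorem length_filter_cast_eq_sum (ρ : ℕ → Bool) :
    ∀ L : List ℕ, (((L.filter fun v => ρ v).length : ℕ) : ZMod 2) =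
      (L.map fun v => if ρ v = true then (1 : ZMod 2) else 0).sum
  | [] => by simp
  | a :: L => by
    rw [List.filter_cons, List.map_cons, List.sum_cons, ← length_filter_cast_eq_sum ρ L]
    by_cases h : ρ a = true
    · simp [h, add_comm]
    · simp [h]

/-- **The clause excluding a wrong-parity assignment.** If the true support variables of `ρ` have
parity `≠ e.2`, then the clause listing the sorted support with signs opposite to `ρ`
(`(v, ¬ρ v)`, falsified exactly by `ρ`) belongs to `equationCNF 1 e`.
[Beck 2017, Def. 5.6] [folklore] -/
theorem map_mem_equationCNF_one (e : LinEqMod 2 n) (ρ : ℕ → Bool)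
    (hpar : (((((e.supp.map Fin.valEmbedding).sort (· ≤ ·)).filter fun v => ρ v).length : ℕ)
      : ZMod 2) ≠ e.2) :
    ((e.supp.map Fin.valEmbedding).sort (· ≤ ·)).map (fun v => (v, !ρ v)) ∈ equationCNF 1 e := by
  set V := (e.supp.map Fin.valEmbedding).sort (· ≤ ·) with hV
  rw [equationCNF, canonicalCNF, eqVars_one, ← hV]
  refine List.mem_map.2 ⟨V.filter fun v => ρ v, List.mem_filter.2 ⟨?_, ?_⟩, ?_⟩
  · exact List.mem_sublists.2 List.filter_sublist
  · -- the parity predicate fails on `V.filter ρ`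
    rw [Bool.not_eq_true', ← Bool.not_eq_true, eqPred_one_iff]
    intro h
    apply hpar
    rw [← h, length_filter_cast_eq_sum, hV, sum_sort_map, Finset.sum_map]
    refine Finset.sum_congr rfl fun j hj => ?_
    have hjV : (j : ℕ) ∈ (e.supp.map Fin.valEmbedding).sort (· ≤ ·) :=
      (mem_sort_supp_iff e).2 ⟨j, hj, rfl⟩
    simp only [List.mem_filter, hjV, true_and]
    rfl
  · refine List.map_congr_left fun v hv => ?_
    simp only [List.mem_filter, hv, true_and, Prod.mk.injEq, true_and]
    cases ρ v <;> simp

end Rows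

end Summit.PneNP.PneNP.Theorems.ModTwo
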